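import Mathlib
import Summits.Ventures.HodgeRepro.Tier4.Line1.RTFSetting
import Summits.Ventures.HodgeRepro.Tier4.Line1.HeckeIsolation
import Summits.Ventures.HodgeRepro.Tier4.Line1.HeckeIsolationHecke
import Summits.Ventures.HodgeRepro.Tier4.Line1.HeckeBlockIdempotent
import Summits.Ventures.HodgeRepro.Tier4.Line1.HeckeIsolationIdempotent
import Summits.Ventures.HodgeRepro.Tier4.Line1.IsotypicIdempotent
import Summits.Ventures.HodgeRepro.Tier4.Line1.IsotypicBlock
import Summits.Ventures.HodgeRepro.Tier4.Line1.IsotypicInstance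
import Summits.Ventures.HodgeRepro.Tier4.Line1.IsotypicHeckeAlgebra
import Summits.Ventures.HodgeRepro.Tier4.Line1.IsotypicBernsteinIso
import Summits.Ventures.HodgeRepro.Tier4.Line1.BlockConstituents
import Summits.Ventures.HodgeRepro.Tier4.Line1.BlockDecomposition
import Summits.Ventures.HodgeRepro.Tier4.Line1.IsotypicIdempotentData

/-!
# Tier4/Line1/IsotypicIdempotentGlue — the type-σ `IdempotentData` with the block decomposition DISCHARGED by name
((C-PROJ) t4-L1-p3 g3's `exists_block_decomposition` consumed): only (C-NZ) and multiplicity one of the cores remain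
displayed on the block side

Blind re-derivation cell `pub-hodge-repro`, Tier 4 (README §9–§10), seat t4-L1-p5 (prover, LINE L1, gen 3; the glue
t4-L1-p3 g3 asked for in S14463 after (C-PROJ) landed, plan-1's (C-PLUG) S14342 completed).  Target tree path
`lean/Summits/Ventures/HodgeRepro/Tier4/Line1/IsotypicIdempotentGlue.lean`.  Consumes by name: p3's `BlockDecomposition`
(p693709: `blockSupport`, `mem_blockSupport`, `exists_block_decomposition`) and `BlockConstituents` (p693204: `Wm`,
`mem_Wm`), p3's `IsotypicHeckeAlgebra` / `IsotypicInstance`, p2's `IsotypicBernsteinIso`, this seat's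
`IsotypicIdempotentData` (p693283: `isotypicConstituent`) and `HeckeIsolationIdempotent` (p691579).

WHAT THIS IS.  `IdempotentData.ofIsotypicDecomposition` (p693283) takes the decomposition of the type-σ block along
the constituents as hypotheses h1–h10.  (C-PROJ) proves it: for the fixed block of ANY idempotent self-adjoint test
function, `exists_block_decomposition` gives the finite support `s` and projectors `P` with the nine clauses, and
`blockSupport` / `mem_blockSupport` name the support (`m ∈ blockSupport ↔ Wm m ≠ ⊥`, i.e. the constituent meets the
block non-trivially — the tenth clause).  Here the two are glued on `Vb := isotypicFixed S K ρ …`, `e := eσ`: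
* `isotypicSupport` = `blockSupport` of the type-σ block; `exists_ne_zero_of_mem_isotypicSupport` /
  `mem_isotypicSupport_of_ne_zero` (the tenth clause and its converse);
* `isotypicProjOf` — the `H_σ`-linear projector of the block built from the decomposition's `P m` (its
  `H_σ`-linearity = the commutation clause with `R(t)`, `t ∈ H_σ` preserving the block);
* **`IdempotentData.ofIsotypicBlock`** — the complete type-σ `IdempotentData` over `H_σ` with index set
  `isotypicSupport`, from (C-NZ) `hne` (a non-zero block vector in `τ m`) and multiplicity one of the cores `hM` ONLY
  (the support `s` of the decomposition contains `isotypicSupport`, and the projectors vanish on `s ∖ isotypicSupport`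
  because there the constituent of the block is `⊥` — so the sum over the support IS the sum over `isotypicSupport`);
* **`isolationRealised_isotypic'`** — (S3″) for the corner forms' type σ, end to end, from `hne` at the constituents
  carrying both periods, `hM`, the two test-vector clauses and the dictionary `RealisedHecke`.
Nothing of (C-NZ), `hM`, the test-vector clauses or the dictionary is proved.  Nothing here says anything about the
status of the Hodge conjecture for CM abelian varieties, which is NOT proved (HC_CM is NOT proved by anyone in this
repository).
-/

set_option autoImplicit false

noncomputable section

namespace Summit.Ventures.HodgeRepro.Tier4.Line1

open MeasureTheory Topology NumberField Common PeriodCloser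

namespace RTF.Setting

variable {G : Type} [Group G] [TopologicalSpace G] [IsTopologicalGroup G] [MeasurableSpace G] [BorelSpace G]
  (S : Setting G) (K : Subgroup G) {d : ℕ} (ρ : K →* Matrix (Fin d) (Fin d) ℂ)
  (hKo : IsOpen (K : Set G)) (hKc : IsCompact (K : Set G)) (hρ : Continuous ρ) (hirr : IsIrreducibleRep ρ)
  (hu : IsUnitaryRep ρ) [Countable S.Gk] [SecondCountableTopology G] [T2Space G] [MeasurableMul G] [SFinite S.μ]
  {τ : ℕ → Set (G → ℂ)} {φ : ℕ → G → ℂ} {n : ℕ → ℕ} (hB : S.IsAdaptedONB τ φ n)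

section Support

omit hirr [SecondCountableTopology G] [T2Space G] [MeasurableMul G] [SFinite S.μ] in
/-- **the support of the type-σ block**: the finitely many constituents meeting `isotypicFixed` non-trivially
(p3's `blockSupport`). -/
def isotypicSupport : Finset ℕ :=
  haveI := finiteDimensional_isotypicFixed S K ρ hKo hKc hρ hu
  blockSupport S hB (isotypicFixed S K ρ hKo hKc hρ) (mem_isotypicFixed S K ρ hKo hKc hρ)

omit hirr [SecondCountableTopology G] [T2Space G] [MeasurableMul G] [SFinite S.μ] in
/-- a constituent of the support carries a non-zero vector of the block (the tenth clause). -/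
theorem exists_ne_zero_of_mem_isotypicSupport {m : ℕ} (hm : m ∈ isotypicSupport S K ρ hKo hKc hρ hu hB) :
    ∃ ψ ∈ isotypicFixed S K ρ hKo hKc hρ, ψ ∈ τ m ∧ ψ ≠ 0 := by
  haveI := finiteDimensional_isotypicFixed S K ρ hKo hKc hρ hu
  rw [isotypicSupport, S.mem_blockSupport hB] at hm
  obtain ⟨ψ, hψ, hne⟩ := Submodule.ne_bot_iff _ |>.mp hm
  rcases ((S.mem_Wm hB _).mp hψ).2 with h | h
  · exact ⟨ψ, ((S.mem_Wm hB _).mp hψ).1, h, hne⟩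
  · exact absurd h hne

omit hirr [SecondCountableTopology G] [T2Space G] [MeasurableMul G] [SFinite S.μ] in
/-- a constituent carrying a non-zero vector of the block is in the support. -/
theorem mem_isotypicSupport_of_ne_zero {m : ℕ}
    (h : ∃ ψ ∈ isotypicFixed S K ρ hKo hKc hρ, ψ ∈ τ m ∧ ψ ≠ 0) : m ∈ isotypicSupport S K ρ hKo hKc hρ hu hB := by
  haveI := finiteDimensional_isotypicFixed S K ρ hKo hKc hρ hu
  rw [isotypicSupport, S.mem_blockSupport hB]
  obtain ⟨ψ, hV, hτ, hne⟩ := h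
  exact (Submodule.ne_bot_iff _).mpr ⟨ψ, (S.mem_Wm hB _).mpr ⟨hV, Or.inl hτ⟩, hne⟩

omit hirr [SecondCountableTopology G] [T2Space G] [MeasurableMul G] [SFinite S.μ] in
/-- off the support the constituent of the block is zero: a block vector in `τ m` with `m ∉ isotypicSupport` is `0`. -/
theorem eq_zero_of_not_mem_isotypicSupport {m : ℕ} (hm : m ∉ isotypicSupport S K ρ hKo hKc hρ hu hB) {ψ : G → ℂ}
    (hV : ψ ∈ isotypicFixed S K ρ hKo hKc hρ) (hτ : ψ ∈ τ m) : ψ = 0 := by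
  by_contra hne
  exact hm (mem_isotypicSupport_of_ne_zero S K ρ hKo hKc hρ hu hB ⟨ψ, hV, hτ, hne⟩)

end Support

section Projector

omit hu in
/-- **the `H_σ`-linear projector of the block from a decomposition projector `P m`** (p3's clauses: into the block,
additive, commuting with every `R(f)` that preserves the block — `R(t)` for `t ∈ H_σ` does). -/
def isotypicProjOf (P : ℕ → (G → ℂ) → (G → ℂ))
    (h1 : ∀ m, ∀ ψ ∈ isotypicFixed S K ρ hKo hKc hρ, P m ψ ∈ isotypicFixed S K ρ hKo hKc hρ)
    (h3 : ∀ m, ∀ ψ ∈ isotypicFixed S K ρ hKo hKc hρ, ∀ ψ' ∈ isotypicFixed S K ρ hKo hKc hρ,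
      P m (ψ + ψ') = P m ψ + P m ψ')
    (h8 : ∀ m, ∀ f, IsTest f → (∀ ψ ∈ isotypicFixed S K ρ hKo hKc hρ, S.R f ψ ∈ isotypicFixed S K ρ hKo hKc hρ) →
      ∀ ψ ∈ isotypicFixed S K ρ hKo hKc hρ, P m (S.R f ψ) = S.R f (P m ψ))
    (m : ℕ) : isotypicFixed S K ρ hKo hKc hρ →ₗ[HeckeAlg S K ρ hKo hKc hρ hirr] isotypicFixed S K ρ hKo hKc hρ where
  toFun ψ := ⟨P m ψ, h1 m ψ ψ.2⟩
  map_add' ψ ψ' := Subtype.ext (by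
    simp only [Submodule.coe_add]
    exact h3 m ψ ψ.2 ψ' ψ'.2)
  map_smul' t ψ := Subtype.ext (by
    simp only [RingHom.id_apply]
    rw [hact_heckeAlg S K ρ hKo hKc hρ hirr, hact_heckeAlg S K ρ hKo hKc hρ hirr]
    exact h8 m (t : G → ℂ) t.2.1 (fun ψ' hψ' => S.R_mem_isotypicFixed K ρ hKo hKc hρ hirr t.2 hψ') ψ ψ.2)

end Projector

section Plug

variable [LocallyCompactSpace G]

/-- **THE COMPLETE type-σ `IdempotentData` OVER `H_σ`, WITH THE DECOMPOSITION DISCHARGED** ((C-PROJ) by name): from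
(C-NZ) `hne` — a non-zero block vector in `τ m` — and multiplicity one of the cores `hM` on the support ONLY.  The
decomposition `exists_block_decomposition` of the type-σ block supplies the projectors; its support contains
`isotypicSupport`, and the projectors vanish on the difference (there the constituent of the block is `⊥`), so the
sum over `isotypicSupport` is the identity. -/
def IdempotentData.ofIsotypicBlock (m : ℕ) (hne : ∃ ψ ∈ isotypicFixed S K ρ hKo hKc hρ, ψ ∈ τ m ∧ ψ ≠ 0)
    (hM : ∀ i j : ↥(isotypicSupport S K ρ hKo hKc hρ hu hB), i ≠ j →
      ¬ S.IsoRep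
        (S.core (isotypicConstituent S K ρ hKo hKc hρ hirr τ hB.inv (isotypicSupport S K ρ hKo hKc hρ hu hB)
          (fun _ hm => exists_ne_zero_of_mem_isotypicSupport S K ρ hKo hKc hρ hu hB hm) i))
        (S.core (isotypicConstituent S K ρ hKo hKc hρ hirr τ hB.inv (isotypicSupport S K ρ hKo hKc hρ hu hB)
          (fun _ hm => exists_ne_zero_of_mem_isotypicSupport S K ρ hKo hKc hρ hu hB hm) j))) :
    haveI := finiteDimensional_isotypicFixed S K ρ hKo hKc hρ hu
    IdempotentData S τ m (HeckeAlg S K ρ hKo hKc hρ hirr) (↥(isotypicSupport S K ρ hKo hKc hρ hu hB))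
      (isotypicFixed S K ρ hKo hKc hρ) :=
  haveI := finiteDimensional_isotypicFixed S K ρ hKo hKc hρ hu
  -- the decomposition of the type-σ block (C-PROJ)
  let ex := S.exists_block_decomposition hB (isotypicFixed S K ρ hKo hKc hρ) (mem_isotypicFixed S K ρ hKo hKc hρ)
    (isTest_eσ S K ρ hKo hKc hρ) (conv_eσ_eσ S K ρ hKo hKc hρ hirr) (cj_refl_eσ S K ρ hu)
  let s' := Classical.choose ex
  let P := Classical.choose (Classical.choose_spec ex)
  have hP := Classical.choose_spec (Classical.choose_spec ex)
  have h1 := hP.1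
  have h2 := hP.2.1
  have h3 := hP.2.2.1
  have h5 := hP.2.2.2.2.1
  have h6 := hP.2.2.2.2.2.1
  have h7 := hP.2.2.2.2.2.2.1
  have h8 := hP.2.2.2.2.2.2.2.1
  have h9 := hP.2.2.2.2.2.2.2.2
  let sup := isotypicSupport S K ρ hKo hKc hρ hu hB
  have h10 : ∀ m ∈ sup, ∃ ψ ∈ isotypicFixed S K ρ hKo hKc hρ, ψ ∈ τ m ∧ ψ ≠ 0 :=
    fun _ hm => exists_ne_zero_of_mem_isotypicSupport S K ρ hKo hKc hρ hu hB hm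
  -- the support of the decomposition contains the block support
  have hsub : sup ⊆ s' := fun m hm => h9 m (h10 m hm)
  let W := isotypicConstituent S K ρ hKo hKc hρ hirr τ hB.inv sup h10
  let π := isotypicProjOf S K ρ hKo hKc hρ hirr P h1 h3 h8
  haveI hsimple : ∀ i : ↥sup, IsSimpleModule (HeckeAlg S K ρ hKo hKc hρ hirr) (W i) := fun i => by
    obtain ⟨ψ, hψV, hψτ, hψne⟩ := h10 i i.2
    exact S.isSimpleModule_isotypic K ρ hKo hKc hρ hirr hu i (hB.inv i) (hB.irred i) (W i)
      (mem_isotypicConstituent S K ρ hKo hKc hρ hirr τ hB.inv sup h10 i)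
      ⟨⟨ψ, hψV⟩, hψτ, fun h => hψne (congrArg Subtype.val h)⟩
  IdempotentData.ofIsotypic S K ρ hKo hKc hρ hu hirr τ m (HeckeAlg S K ρ hKo hKc hρ hirr) (↥sup)
    (fun t => (t : G → ℂ)) (fun t => t.2.1) (fun t => t.2.2.2) (hact_heckeAlg S K ρ hKo hKc hρ hirr)
    (fun i => (i : ℕ)) ⟨m, mem_isotypicSupport_of_ne_zero S K ρ hKo hKc hρ hu hB hne⟩ rfl W
    (mem_isotypicConstituent S K ρ hKo hKc hρ hirr τ hB.inv sup h10) (fun i => π (i : ℕ))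
    (fun i v => h2 i (hsub i.2) v v.2)
    (fun v => Subtype.ext (by
      simp only [Submodule.coe_sum]
      rw [Finset.sum_coe_sort sup (fun i => ((π i v : isotypicFixed S K ρ hKo hKc hρ) : G → ℂ))]
      -- the sum over the block support is the sum over the decomposition's support
      have hzero : ∀ i ∈ s', i ∉ sup → ((π i v : isotypicFixed S K ρ hKo hKc hρ) : G → ℂ) = 0 := by
        intro i hi hnot
        exact eq_zero_of_not_mem_isotypicSupport S K ρ hKo hKc hρ hu hB hnot (h1 i v v.2) (h2 i hi v v.2)
      rw [Finset.sum_subset hsub hzero]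
      exact h5 v v.2))
    (fun i w hw => Subtype.ext (h6 i w w.2 hw))
    (fun i j hij w hw => Subtype.ext (h7 i j (fun h => hij (Subtype.ext h)) w w.2 hw))
    (S.hnon_of_multiplicityOne_core (isTest_eσ S K ρ hKo hKc hρ) (mem_isotypicFixed S K ρ hKo hKc hρ)
      (hact_heckeAlg S K ρ hKo hKc hρ hirr) (fun _ hf => S.hfull_heckeAlg K ρ hKo hKc hρ hirr hf) hB.inv hB.irred
      (mem_isotypicConstituent S K ρ hKo hKc hρ hirr τ hB.inv sup h10) hM)

end Plug

end RTF.Setting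

section Assembly

variable {Form : Type} [AddCommGroup Form] [Module ℂ Form] {A : FormAlgebra Form} {W : Witness A}
  {G : Type} [Group G] [TopologicalSpace G] [IsTopologicalGroup G] [MeasurableSpace G] [BorelSpace G]
  (S : RTF.Setting G) (χ : S.T → ℂ) (χ' : S.T' → ℂ) (τ : ℕ → Set (G → ℂ)) (Lift : ℕ → Prop)
  (φ : ℕ → G → ℂ) (n : ℕ → ℕ) (tf : W.Translates → (G → ℂ) × (G → ℂ))
  (K : Subgroup G) {d : ℕ} (ρ : K →* Matrix (Fin d) (Fin d) ℂ)
  (hKo : IsOpen (K : Set G)) (hKc : IsCompact (K : Set G)) (hρ : Continuous ρ)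
  (hirr : RTF.Setting.IsIrreducibleRep ρ)

/-- **(S3″) FOR THE CORNER FORMS' TYPE σ, END TO END, WITH THE DECOMPOSITION DISCHARGED**: `IsolationRealised` from
the type-σ block with its kernel Hecke algebra `H_σ`, non-zero block vectors at the constituents carrying both periods
(C-NZ), multiplicity one of the cores on the support (`hM`, DISPLAYED), the test-vector clauses and the dictionary
`RealisedHecke`.  `Lift` is not used. -/
theorem isolationRealised_isotypic' [Countable S.Gk] [MeasurableMul G] [SecondCountableTopology G] [T2Space G]
    [SFinite S.μ] [LocallyCompactSpace G] (hu : RTF.Setting.IsUnitaryRep ρ) (hB : S.IsAdaptedONB τ φ n)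
    (hne : ∀ m, S.PeriodNonzeroT χ (τ m) → S.PeriodNonzeroT' χ' (τ m) →
      ∃ ψ ∈ RTF.Setting.isotypicFixed S K ρ hKo hKc hρ, ψ ∈ τ m ∧ ψ ≠ 0)
    (hM : ∀ i j : ↥(RTF.Setting.isotypicSupport S K ρ hKo hKc hρ hu hB), i ≠ j →
      ¬ S.IsoRep
        (S.core (RTF.Setting.isotypicConstituent S K ρ hKo hKc hρ hirr τ hB.inv
          (RTF.Setting.isotypicSupport S K ρ hKo hKc hρ hu hB)
          (fun _ hm => RTF.Setting.exists_ne_zero_of_mem_isotypicSupport S K ρ hKo hKc hρ hu hB hm) i))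
        (S.core (RTF.Setting.isotypicConstituent S K ρ hKo hKc hρ hirr τ hB.inv
          (RTF.Setting.isotypicSupport S K ρ hKo hKc hρ hu hB)
          (fun _ hm => RTF.Setting.exists_ne_zero_of_mem_isotypicSupport S K ρ hKo hKc hρ hu hB hm) j)))
    (hPA : ∀ m, S.PeriodNonzeroT χ (τ m) →
      ∃ w ∈ RTF.Setting.blockAdmissible τ m (RTF.Setting.isotypicFixed S K ρ hKo hKc hρ),
        S.periodT χ (fun t => w t) ≠ 0)
    (hPA' : ∀ m, S.PeriodNonzeroT' χ' (τ m) →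
      ∃ w' ∈ RTF.Setting.blockAdmissible τ m (RTF.Setting.isotypicFixed S K ρ hKo hKc hρ),
        S.periodT' χ' (fun t' => w' t') ≠ 0)
    (hreal : RealisedHecke S χ χ' φ n tf (RTF.Setting.HeckeAlg S K ρ hKo hKc hρ hirr) (fun t => (t : G → ℂ))) :
    IsolationRealised S χ χ' τ Lift φ n tf := by
  haveI := RTF.Setting.finiteDimensional_isotypicFixed S K ρ hKo hKc hρ hu
  exact isolationRealised_of_idempotentData S χ χ' τ Lift φ n tf (RTF.Setting.HeckeAlg S K ρ hKo hKc hρ hirr)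
    (fun t => (t : G → ℂ)) hB (fun _ => ↥(RTF.Setting.isotypicSupport S K ρ hKo hKc hρ hu hB))
    (fun _ => RTF.Setting.isotypicFixed S K ρ hKo hKc hρ)
    (fun m hT hT' => RTF.Setting.IdempotentData.ofIsotypicBlock S K ρ hKo hKc hρ hirr hu hB m (hne m hT hT') hM)
    (fun _ _ _ => rfl) hPA hPA' hreal

end Assembly

end Summit.Ventures.HodgeRepro.Tier4.Line1

end
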